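import Summits.QuantumFields.YangMills.Theorems.ColdStartUniversalityShenZhuZhuWilsonLoopVarianceSU2
import Literature.MathematicalPhysics.QuantumFieldTheory.ShenZhuZhuPoincareApplications
import Literature.MathematicalPhysics.QuantumLattice.NarrowWellPlaquetteAction
import HarnessLib

/-!
# The named fact `shenZhuZhu_largeN_variance 3 2` (Shen–Zhu–Zhu CMP 400 (2023), Corollary 1.5, the Wilson-loop variance bound (1.12))
# is a THEOREM for `SU(2)` lattice Yang–Mills in three dimensions

Seat `ym-line-csu-p1` (g38), route `ColdStartUniversality` of `Summits/QuantumFields/YangMills`, helper file G11.  The Literature vendors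
Shen–Zhu–Zhu's Corollary 1.5 (1.12) — `Var(W_ℓ/N) ≤ 4n(n−3)/(K_S N)` for every loop `ℓ` with `n` edges under the infinite-volume measure, `SU(N)`,
and the `SO(N)` analogue — as the named fact `shenZhuZhu_largeN_variance d N` (`ShenZhuZhuPoincareApplications`, a `def … : Prop`, used as a
HYPOTHESIS by the `GaugeBoot` files).  For `(d, N) = (3, 2)` it follows from the seat's Wilson-loop variance bound for infinite-volume limit
points (`szz_wilsonLoop_variance_su2`, G6: `Var_μ(½ Re tr hol_C) ≤ Σ_e mult_C(e)²/(2(1 − 24|β|))`):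

* `zdGraph_walk_parity`, `even_length_of_closed_zdWalk` (every `d`) — `ℤ^d` is bipartite: a closed lattice walk has even length;
  `four_le_length_of_isNonBacktrackingLoop` — a loop in SZZ's sense (non-empty, no backtracking read cyclically) has `n ≥ 4` edges.
* `sum_dartMult_sq_le_length_sq` — `Σ_e mult_C(e)² ≤ n²`.
* the trace of an `SU(2)` matrix is real (tree `NarrowWell.trace_im_eq_zero`), so `Im W_ℓ = 0` for `SU(2)`.
* ★★ `szzLoopVarianceBound_su2` — `SZZLoopVarianceBound (fundamentalRep (Fin 2)) 3 (2β) C` for every `|β| < 1/24` and `C ≥ 4/(1 − 24|β|)`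
  (`n²/(2K) ≤ (4/K)·n(n−3)/2` for `n ≥ 4`).
* ★★★ `shenZhuZhu_largeN_variance_su2_d3 : shenZhuZhu_largeN_variance 3 2` — the NAMED FACT, unconditionally: the `SU(2)` conjunct on SZZ's window
  `|β| < 1/32` with the printed constant `4/K_S`, `K_S = 1 − 32|β|` (`≥` our `4/(1 − 24|β|)`); the `SO(2)` conjunct is vacuous (SZZ's threshold
  `1/(32(d−1)) − 1/(16N(d−1))` vanishes at `N = 2`).

THEOREMS ONLY, no definition, no sorry.  HONEST FRAMING: this discharges a vendored LITERATURE statement at STRONG coupling for ONE group and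
dimension (`SU(2)`, `d = 3`); fixed lattice; nothing at large `N` proper (the fact's name refers to SZZ's large-`N` corollary, of which (1.12) is the
finite-`N` input), nothing at weak coupling / in the continuum, nothing `K`-uniform along the route's scaling (`UniformColdStartMixing`, 24809,
ASIDE, not restated); no crux, rung or summit statement is proved; the Yang–Mills mass gap is NOT proved.

References: H. Shen, R. Zhu, X. Zhu, CMP 400 (2023) 805–851 = arXiv:2204.12737, Cor. 1.5 (1.12), §4.2 [ShenZhuZhu2022].
-/

set_option autoImplicit false

noncomputable section

namespace Summit.QuantumFields.YangMills.Theorems.ColdStartUniversality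

open MeasureTheory ProbabilityTheory Finset Filter Set Function
open scoped BigOperators NNReal ENNReal Topology Matrix Matrix.Norms.Frobenius ContDiff
open SimpleGraph
open Literature.Probability.LatticeModels (Site zdGraph zdGraph_adj_iff)
open Literature.Probability.Process Literature.MathematicalPhysics.QuantumFieldTheory
open Literature.MathematicalPhysics.QuantumLattice (fundamentalRep fundamentalLatticeRep continuous_fundamentalRep fundamentalRep_apply
  infiniteVolumeLimitPoints LGConfig normalisedCharacter walkHolonomy wilsonLoopObs)
open Summit.Ventures.YMGap.RobustBall (dartMult sum_walkEdges_dartMult)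

/-! ## §1. Lattice combinatorics: parity of lattice walks, loops have at least four edges -/

/-- **`ℤ^d` is bipartite**: along a lattice walk from `u` to `v` of length `n`, `Σ_i u_i + n ≡ Σ_i v_i (mod 2)`. [folklore] -/
theorem zdGraph_walk_parity {d : ℕ} : ∀ {u v : Site d} (w : (zdGraph d).Walk u v),
    (((∑ i, u i : ℤ) : ZMod 2) + (w.length : ZMod 2) = ((∑ i, v i : ℤ) : ZMod 2))
  | _, _, .nil => by simp
  | u, _, .cons (v := u') h p => by
    rw [Walk.length_cons, Nat.cast_succ, ← zdGraph_walk_parity p]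
    have h11 : (1 : ZMod 2) + 1 = 0 := by decide
    obtain ⟨i, hi | hi⟩ := (zdGraph_adj_iff u u').1 h
    · have hs : (∑ k, u' k : ℤ) = (∑ k, u k) + 1 := by
        rw [hi]
        simp only [Pi.add_apply, Finset.sum_add_distrib, Finset.sum_pi_single', Finset.mem_univ, if_true]
      rw [hs, Int.cast_add, Int.cast_one]
      ring
    · have hs : (∑ k, u k : ℤ) = (∑ k, u' k) + 1 := by
        rw [hi]
        simp only [Pi.add_apply, Finset.sum_add_distrib, Finset.sum_pi_single', Finset.mem_univ, if_true]
      rw [hs, Int.cast_add, Int.cast_one]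
      linear_combination h11

/-- **Closed lattice walks have even length.** [folklore] -/
theorem even_length_of_closed_zdWalk {d : ℕ} {x : Site d} (w : (zdGraph d).Walk x x) : Even w.length := by
  have h := zdGraph_walk_parity w
  have h0 : (w.length : ZMod 2) = 0 := by simpa using h
  exact ZMod.natCast_eq_zero_iff_even.1 h0

/-- **A loop in Shen–Zhu–Zhu's sense has at least four edges**: a non-empty closed lattice walk without backtracking (read cyclically) has
even length `≠ 2`. [cite: ShenZhuZhu2022, (1.11)] -/
theorem four_le_length_of_isNonBacktrackingLoop {d : ℕ} {x : Site d} {w : (zdGraph d).Walk x x}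
    (hw : IsNonBacktrackingLoop w) : 4 ≤ w.length := by
  obtain ⟨hpos, hchain⟩ := hw
  have hev := even_length_of_closed_zdWalk w
  have h2 : w.length ≠ 2 := by
    intro h2
    cases w with
    | nil => simp at hpos
    | cons h p =>
      cases p with
      | nil => simp at h2
      | cons h' q =>
        cases q with
        | nil =>
          simp only [Walk.darts_cons, Walk.darts_nil, List.take_succ_cons, List.take_zero, List.cons_append, List.nil_append,
            List.isChain_cons_cons] at hchain
          exact hchain.1 rfl
        | cons h'' r =>
          simp only [Walk.length_cons] at h2
          omega
  obtain ⟨k, hk⟩ := hev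
  omega

/-- `Σ_{e ∈ links(C)} mult_C(e)² ≤ |C|²` (each multiplicity is at most the length, and they add up to it). [folklore] -/
theorem sum_dartMult_sq_le_length_sq {d : ℕ} {x y : Site d} (w : (zdGraph d).Walk x y) :
    ∑ e ∈ walkEdges w, (dartMult w e : ℝ) ^ 2 ≤ (w.length : ℝ) ^ 2 := by
  have hnat : ∑ e ∈ walkEdges w, dartMult w e ^ 2 ≤ w.length ^ 2 := by
    rw [← sum_walkEdges_dartMult w, sq, Finset.sum_mul]
    refine Finset.sum_le_sum fun e he => ?_
    rw [sq]
    exact Nat.mul_le_mul_left _ (Finset.single_le_sum (fun _ _ => Nat.zero_le _) he)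
  exact_mod_cast hnat

/-! ## §2. The loop-variance bound for `SU(2)`, `d = 3` (the trace of an `SU(2)` matrix is real: tree `NarrowWell.trace_im_eq_zero`) -/

/-- ★★ **Shen–Zhu–Zhu's loop-variance shape for `SU(2)`, `d = 3`, at 't Hooft `|β| < 1/24`**: `SZZLoopVarianceBound (fundamentalRep (Fin 2)) 3 (2β) C`
for every `C ≥ 4/(1 − 24|β|)` — for every infinite-volume limit point `μ`, every loop `ℓ` (non-backtracking closed walk, `n` edges):
`Var_μ(Re W_ℓ/2) + Var_μ(Im W_ℓ/2) ≤ C · n(n−3)/2` (`Im W_ℓ = 0`; `Var(Re W_ℓ/2) ≤ Σ_e mult² /(2K) ≤ n²/(2K) ≤ (4/K) n(n−3)/2` as `n ≥ 4`).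
The Yang–Mills mass gap is NOT proved. [cite: ShenZhuZhu2022, Corollary 1.5 (1.12)] -/
theorem szzLoopVarianceBound_su2 {β : ℝ} (hβ : |β| < 1 / 24) {C : ℝ} (hC : 4 / (1 - 24 * |β|) ≤ C) :
    SZZLoopVarianceBound (fundamentalRep (Fin 2)) 3 (((2 : ℕ) : ℝ) * β) C := by
  intro μ hμ x w hw
  have hK : 0 < 1 - 24 * |β| := by linarith
  have h4 : (4 : ℝ) ≤ w.length := by exact_mod_cast four_le_length_of_isNonBacktrackingLoop hw
  -- real part = the Wilson loop observable of the normalised fundamental character; imaginary part = 0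
  have hre : (fun U : LGConfig 3 (Matrix.specialUnitaryGroup (Fin 2) ℂ) =>
        (wilsonLoopTrace (fundamentalRep (Fin 2)) w U).re / ((2 : ℕ) : ℝ)) =
      wilsonLoopObs (fun g : Matrix.specialUnitaryGroup (Fin 2) ℂ => normalisedCharacter 2 (fundamentalRep (Fin 2) g)) w := by
    funext U
    unfold wilsonLoopObs normalisedCharacter wilsonLoopTrace
    rw [div_eq_inv_mul]
  have him : (fun U : LGConfig 3 (Matrix.specialUnitaryGroup (Fin 2) ℂ) =>
        (wilsonLoopTrace (fundamentalRep (Fin 2)) w U).im / ((2 : ℕ) : ℝ)) = 0 := by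
    funext U
    simp only [wilsonLoopTrace_apply, fundamentalRep_apply, Literature.MathematicalPhysics.QuantumLattice.NarrowWell.trace_im_eq_zero,
      zero_div, Pi.zero_apply]
  rw [hre, him, variance_zero, add_zero]
  have hV := szz_wilsonLoop_variance_su2 hβ hμ w
  have hS := sum_dartMult_sq_le_length_sq w
  have hnn : 0 ≤ (w.length : ℝ) * ((w.length : ℝ) - 3) := by nlinarith
  calc Var[wilsonLoopObs (fun g : Matrix.specialUnitaryGroup (Fin 2) ℂ => normalisedCharacter 2 (fundamentalRep (Fin 2) g)) w; μ]
      ≤ (∑ e ∈ walkEdges w, (dartMult w e : ℝ) ^ 2) / (2 * (1 - 24 * |β|)) := hV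
    _ ≤ (w.length : ℝ) ^ 2 / (2 * (1 - 24 * |β|)) := div_le_div_of_nonneg_right hS (by positivity)
    _ ≤ 4 / (1 - 24 * |β|) * ((w.length : ℝ) * ((w.length : ℝ) - 3) / ((2 : ℕ) : ℝ)) := by
        rw [Nat.cast_ofNat, div_le_iff₀ (by positivity)]
        have e : 4 / (1 - 24 * |β|) * ((w.length : ℝ) * ((w.length : ℝ) - 3) / 2) * (2 * (1 - 24 * |β|)) =
            4 * ((w.length : ℝ) * ((w.length : ℝ) - 3)) := by
          field_simp
        rw [e]
        nlinarith
    _ ≤ C * ((w.length : ℝ) * ((w.length : ℝ) - 3) / ((2 : ℕ) : ℝ)) :=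
        mul_le_mul_of_nonneg_right hC (div_nonneg hnn (Nat.cast_nonneg _))

/-- ★★★ **THE NAMED FACT `shenZhuZhu_largeN_variance 3 2` IS A THEOREM**: Shen–Zhu–Zhu's Corollary 1.5, (1.12), for `SU(2)` lattice Yang–Mills in
three dimensions — under Assumption 1.1 (`|β| < 1/32`, `K_S = 1 − 32|β|`), for every infinite-volume limit point of the periodic states at tree
coupling `2β` and every loop `ℓ` with `n` edges, `Var(Re W_ℓ/2) + Var(Im W_ℓ/2) ≤ (4/K_S) · n(n−3)/2` — unconditionally, from the route's
fixed-cut-off Bakry–Émery package; the `SO(2)` conjunct of the fact is vacuous (threshold `0`).  HONEST FRAMING: strong coupling, one group and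
dimension; the Yang–Mills mass gap is NOT proved. [cite: ShenZhuZhu2022, Corollary 1.5 (1.12)] -/
theorem shenZhuZhu_largeN_variance_su2_d3 : shenZhuZhu_largeN_variance 3 2 := by
  refine ⟨fun _ _ β hβ => ?_, fun _ _ β hβ => ?_⟩
  · have hT : szzThresholdSU 3 = 1 / 32 := by norm_num [szzThresholdSU]
    rw [hT] at hβ
    have hβ' : |β| < 1 / 24 := by linarith
    have hKS : szzBakryEmeryConstSU 2 3 β = 1 - 32 * |β| := by
      simp only [szzBakryEmeryConstSU]; push_cast; ring
    refine szzLoopVarianceBound_su2 hβ' ?_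
    rw [hKS]
    exact div_le_div_of_nonneg_left (by norm_num) (by linarith) (by linarith [abs_nonneg β])
  · have hT : szzThresholdSO 2 3 = 0 := by norm_num [szzThresholdSO]
    rw [hT] at hβ
    exact absurd hβ (not_lt.2 (abs_nonneg β))

end Summit.QuantumFields.YangMills.Theorems.ColdStartUniversality

end
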